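import Mathlib
import Literature.MeasureTheory.Integral.HPolyhedronVerticalFibres
import HarnessLib

/-!
# The top graph of an H-polyhedron decomposes into its active affine pieces

Topic `Literature/MeasureTheory/Integral`; namespace `Literature.MeasureTheory.Integral`.
Continuation of `HPolyhedronVerticalFibres`: for
`P = {(x,t) | ∀ j ∈ J, A j x + c j t ≤ b j}` the upper graph is
`hi x = min_{c j > 0} (b j − A j x)/c j`.  Breaking ties by the LEAST index (any linear order on the
index type), the base splits into the measurable, pairwise DISJOINT pieces
`D_j = {x ∈ D | the j-th upper constraint is the least active one at x}` (`j` with `c j > 0`), on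
which `hi x = (b j − A j x)/c j`; hence for any integrand
`∫_D Φ(x, hi x) dx = Σ_{j : c j > 0} ∫_{D_j} Φ(x, (b j − A j x)/c j) dx`
(`setIntegral_top_eq_sum_active`).  With `setIntegral_deriv_hPolyhedron` this writes the vertical
component of Gauss–Green for a convex polyhedron as a sum over its upper (and, symmetrically,
lower) constraints — brick L3 of the facet-formula programme (crystal3d-full eng MEMO-5).  The
identification of `D_j` with the vertical projection of the `j`-th FACET up to a null set, and of
the piece integrals with facet integrals (Jacobian `|c j|/‖(A j, c j)‖`), is NOT done here.
-/

noncomputable section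

namespace Literature.MeasureTheory.Integral

open _root_.MeasureTheory Set Finset

variable {ι : Type*} [LinearOrder ι]

/-- **Least active upper constraint.**  At every point some upper constraint attains the minimum
`hi x`, and the least such index beats every smaller index strictly.
[cite: EvansGariepy2015, Thm 5.16 (Gauss–Green), polyhedral case — plumbing] -/
theorem exists_least_active {J : Finset ι} (A : ι → (ℝ × ℝ) → ℝ) (c b : ι → ℝ)
    (hup : (J.filter fun j => 0 < c j).Nonempty) (x : ℝ × ℝ) :
    ∃ j ∈ J.filter (fun j => 0 < c j),
      (b j - A j x) / c j = (J.filter fun j => 0 < c j).inf' hup (fun j => (b j - A j x) / c j) ∧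
      ∀ k ∈ J.filter (fun j => 0 < c j), k < j →
        (J.filter fun j => 0 < c j).inf' hup (fun j => (b j - A j x) / c j) < (b k - A k x) / c k := by
  classical
  set U := J.filter (fun j => 0 < c j) with hU
  set m := U.inf' hup (fun j => (b j - A j x) / c j) with hm
  obtain ⟨k₀, hk₀U, hk₀⟩ := Finset.exists_mem_eq_inf' hup (fun j => (b j - A j x) / c j)
  set T := U.filter (fun k => (b k - A k x) / c k = m) with hT
  have hTne : T.Nonempty := ⟨k₀, Finset.mem_filter.2 ⟨hk₀U, by rw [hm, hk₀]⟩⟩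
  set j := T.min' hTne with hj
  have hjT : j ∈ T := Finset.min'_mem T hTne
  rw [Finset.mem_filter] at hjT
  refine ⟨j, hjT.1, hjT.2, fun k hk hkj => ?_⟩
  have hle : m ≤ (b k - A k x) / c k := Finset.inf'_le _ hk
  rcases hle.lt_or_eq with h | h
  · exact h
  · exfalso
    have hkT : k ∈ T := Finset.mem_filter.2 ⟨hk, h.symm⟩
    exact absurd (Finset.min'_le T k hkT) (not_le.2 (hj ▸ hkj))

/-- The piece of the base where `j` is the least active upper constraint is measurable.
[cite: EvansGariepy2015, Thm 5.16 (Gauss–Green), polyhedral case — plumbing] -/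
theorem measurableSet_activePiece {J : Finset ι} {A : ι → (ℝ × ℝ) → ℝ}
    (hA : ∀ j, Continuous (A j)) (c b : ι → ℝ) (hup : (J.filter fun j => 0 < c j).Nonempty)
    {D : Set (ℝ × ℝ)} (hD : MeasurableSet D) (j : ι) :
    MeasurableSet {x : ℝ × ℝ | x ∈ D ∧
      (b j - A j x) / c j = (J.filter fun j => 0 < c j).inf' hup (fun j => (b j - A j x) / c j) ∧
      ∀ k ∈ J.filter (fun j => 0 < c j), k < j →
        (J.filter fun j => 0 < c j).inf' hup (fun j => (b j - A j x) / c j) <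
          (b k - A k x) / c k} := by
  have hhi : Measurable fun x : ℝ × ℝ =>
      (J.filter fun j => 0 < c j).inf' hup (fun j => (b j - A j x) / c j) :=
    (continuous_hiGraph hA c b hup).measurable
  have hv : ∀ k, Measurable fun x : ℝ × ℝ => (b k - A k x) / c k := fun k =>
    ((continuous_const.sub (hA k)).div_const _).measurable
  have h1 : MeasurableSet {x : ℝ × ℝ |
      (b j - A j x) / c j = (J.filter fun j => 0 < c j).inf' hup (fun j => (b j - A j x) / c j)} :=
    measurableSet_eq_fun (hv j) hhi
  have h2 : MeasurableSet {x : ℝ × ℝ | ∀ k ∈ J.filter (fun j => 0 < c j), k < j →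
      (J.filter fun j => 0 < c j).inf' hup (fun j => (b j - A j x) / c j) < (b k - A k x) / c k} := by
    have : {x : ℝ × ℝ | ∀ k ∈ J.filter (fun j => 0 < c j), k < j →
        (J.filter fun j => 0 < c j).inf' hup (fun j => (b j - A j x) / c j) <
          (b k - A k x) / c k} =
        ⋂ k ∈ J.filter (fun j => 0 < c j), {x : ℝ × ℝ | k < j →
          (J.filter fun j => 0 < c j).inf' hup (fun j => (b j - A j x) / c j) <
            (b k - A k x) / c k} := by
      ext x; simp only [mem_setOf_eq, mem_iInter]
    rw [this]
    refine MeasurableSet.biInter (Finset.countable_toSet _) fun k _ => ?_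
    by_cases hkj : k < j
    · have : {x : ℝ × ℝ | k < j →
          (J.filter fun j => 0 < c j).inf' hup (fun j => (b j - A j x) / c j) <
            (b k - A k x) / c k} =
          {x | (J.filter fun j => 0 < c j).inf' hup (fun j => (b j - A j x) / c j) <
            (b k - A k x) / c k} := by
        ext x; simp [hkj]
      rw [this]; exact measurableSet_lt hhi (hv k)
    · have : {x : ℝ × ℝ | k < j →
          (J.filter fun j => 0 < c j).inf' hup (fun j => (b j - A j x) / c j) <
            (b k - A k x) / c k} = univ := by
        ext x; simp [hkj]
      rw [this]; exact MeasurableSet.univ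
  simpa only [setOf_and, setOf_mem_eq] using hD.inter (h1.inter h2)

/-- **The top graph as a sum over active constraints.**  For any measurable base `D` and any
integrand `Φ` with `x ↦ Φ x (hi x)` integrable on `D`:
`∫_D Φ(x, hi x) = Σ_{j : c j > 0} ∫_{D_j} Φ(x, (b j − A j x)/c j)`, the pieces `D_j` (least active
index `j`) being measurable and pairwise disjoint with union `D`.
[cite: EvansGariepy2015, Thm 5.16 (Gauss–Green), polyhedral case — decomposition of the upper graph] -/
theorem setIntegral_top_eq_sum_active {J : Finset ι} {A : ι → (ℝ × ℝ) → ℝ}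
    (hA : ∀ j, Continuous (A j)) (c b : ι → ℝ) (hup : (J.filter fun j => 0 < c j).Nonempty)
    {D : Set (ℝ × ℝ)} (hD : MeasurableSet D) (Φ : (ℝ × ℝ) → ℝ → ℝ)
    (hint : IntegrableOn (fun x => Φ x
      ((J.filter fun j => 0 < c j).inf' hup (fun j => (b j - A j x) / c j))) D volume) :
    ∫ x in D, Φ x ((J.filter fun j => 0 < c j).inf' hup (fun j => (b j - A j x) / c j)) =
      ∑ j ∈ J.filter (fun j => 0 < c j),
        ∫ x in {x : ℝ × ℝ | x ∈ D ∧
          (b j - A j x) / c j = (J.filter fun j => 0 < c j).inf' hup (fun j => (b j - A j x) / c j) ∧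
          ∀ k ∈ J.filter (fun j => 0 < c j), k < j →
            (J.filter fun j => 0 < c j).inf' hup (fun j => (b j - A j x) / c j) <
              (b k - A k x) / c k}, Φ x ((b j - A j x) / c j) := by
  classical
  set U := J.filter (fun j => 0 < c j) with hU
  set hi : (ℝ × ℝ) → ℝ := fun x => U.inf' hup (fun j => (b j - A j x) / c j) with hhi
  set piece : ι → Set (ℝ × ℝ) := fun j => {x : ℝ × ℝ | x ∈ D ∧ (b j - A j x) / c j = hi x ∧
    ∀ k ∈ U, k < j → hi x < (b k - A k x) / c k} with hpiece
  have hmeas : ∀ j ∈ U, MeasurableSet (piece j) := fun j _ =>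
    measurableSet_activePiece hA c b hup hD j
  have hdisj : Set.Pairwise (↑U : Set ι) (Function.onFun Disjoint piece) := by
    intro j hj k hk hjk
    rw [Function.onFun, Set.disjoint_left]
    intro x hxj hxk
    rcases lt_or_gt_of_ne hjk with h | h
    · have := hxk.2.2 j hj h
      rw [hxj.2.1] at this
      exact lt_irrefl _ this
    · have := hxj.2.2 k hk h
      rw [hxk.2.1] at this
      exact lt_irrefl _ this
  have hcover : D = ⋃ j ∈ U, piece j := by
    ext x
    simp only [mem_iUnion, exists_prop]
    constructor
    · intro hx
      obtain ⟨j, hjU, hj1, hj2⟩ := exists_least_active A c b hup x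
      exact ⟨j, hjU, hx, hj1, hj2⟩
    · rintro ⟨j, -, hx, -⟩; exact hx
  have step1 : ∫ x in D, Φ x (hi x) = ∑ j ∈ U, ∫ x in piece j, Φ x (hi x) := by
    rw [hcover]
    refine integral_biUnion_finset U hmeas hdisj fun j hj => ?_
    exact hint.mono_set (fun x hx => hx.1)
  rw [step1]
  refine Finset.sum_congr rfl fun j hj => ?_
  refine setIntegral_congr_fun (hmeas j hj) fun x hx => ?_
  rw [← hx.2.1]

/-- **Least active lower constraint.**  At every point some lower constraint attains the maximum
`lo x`, and the least such index beats every smaller index strictly.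
[cite: EvansGariepy2015, Thm 5.16 (Gauss–Green), polyhedral case — plumbing] -/
theorem exists_least_active_lower {J : Finset ι} (A : ι → (ℝ × ℝ) → ℝ) (c b : ι → ℝ)
    (hlow : (J.filter fun j => c j < 0).Nonempty) (x : ℝ × ℝ) :
    ∃ j ∈ J.filter (fun j => c j < 0),
      (b j - A j x) / c j = (J.filter fun j => c j < 0).sup' hlow (fun j => (b j - A j x) / c j) ∧
      ∀ k ∈ J.filter (fun j => c j < 0), k < j →
        (b k - A k x) / c k < (J.filter fun j => c j < 0).sup' hlow (fun j => (b j - A j x) / c j) := by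
  classical
  set U := J.filter (fun j => c j < 0) with hU
  set m := U.sup' hlow (fun j => (b j - A j x) / c j) with hm
  obtain ⟨k₀, hk₀U, hk₀⟩ := Finset.exists_mem_eq_sup' hlow (fun j => (b j - A j x) / c j)
  set T := U.filter (fun k => (b k - A k x) / c k = m) with hT
  have hTne : T.Nonempty := ⟨k₀, Finset.mem_filter.2 ⟨hk₀U, by rw [hm, hk₀]⟩⟩
  set j := T.min' hTne with hj
  have hjT : j ∈ T := Finset.min'_mem T hTne
  rw [Finset.mem_filter] at hjT
  refine ⟨j, hjT.1, hjT.2, fun k hk hkj => ?_⟩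
  have hle : (b k - A k x) / c k ≤ m := Finset.le_sup' (fun j => (b j - A j x) / c j) hk
  rcases hle.lt_or_eq with h | h
  · exact h
  · exfalso
    have hkT : k ∈ T := Finset.mem_filter.2 ⟨hk, h⟩
    exact absurd (Finset.min'_le T k hkT) (not_le.2 (hj ▸ hkj))

/-- The piece of the base where `j` is the least active lower constraint is measurable.
[cite: EvansGariepy2015, Thm 5.16 (Gauss–Green), polyhedral case — plumbing] -/
theorem measurableSet_activePiece_lower {J : Finset ι} {A : ι → (ℝ × ℝ) → ℝ}
    (hA : ∀ j, Continuous (A j)) (c b : ι → ℝ) (hlow : (J.filter fun j => c j < 0).Nonempty)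
    {D : Set (ℝ × ℝ)} (hD : MeasurableSet D) (j : ι) :
    MeasurableSet {x : ℝ × ℝ | x ∈ D ∧
      (b j - A j x) / c j = (J.filter fun j => c j < 0).sup' hlow (fun j => (b j - A j x) / c j) ∧
      ∀ k ∈ J.filter (fun j => c j < 0), k < j →
        (b k - A k x) / c k <
          (J.filter fun j => c j < 0).sup' hlow (fun j => (b j - A j x) / c j)} := by
  have hlo' : Measurable fun x : ℝ × ℝ =>
      (J.filter fun j => c j < 0).sup' hlow (fun j => (b j - A j x) / c j) :=
    (continuous_loGraph hA c b hlow).measurable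
  have hv : ∀ k, Measurable fun x : ℝ × ℝ => (b k - A k x) / c k := fun k =>
    ((continuous_const.sub (hA k)).div_const _).measurable
  have h1 : MeasurableSet {x : ℝ × ℝ |
      (b j - A j x) / c j = (J.filter fun j => c j < 0).sup' hlow (fun j => (b j - A j x) / c j)} :=
    measurableSet_eq_fun (hv j) hlo'
  have h2 : MeasurableSet {x : ℝ × ℝ | ∀ k ∈ J.filter (fun j => c j < 0), k < j →
      (b k - A k x) / c k < (J.filter fun j => c j < 0).sup' hlow (fun j => (b j - A j x) / c j)} := by
    have : {x : ℝ × ℝ | ∀ k ∈ J.filter (fun j => c j < 0), k < j →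
        (b k - A k x) / c k <
          (J.filter fun j => c j < 0).sup' hlow (fun j => (b j - A j x) / c j)} =
        ⋂ k ∈ J.filter (fun j => c j < 0), {x : ℝ × ℝ | k < j →
          (b k - A k x) / c k <
            (J.filter fun j => c j < 0).sup' hlow (fun j => (b j - A j x) / c j)} := by
      ext x; simp only [mem_setOf_eq, mem_iInter]
    rw [this]
    refine MeasurableSet.biInter (Finset.countable_toSet _) fun k _ => ?_
    by_cases hkj : k < j
    · have : {x : ℝ × ℝ | k < j →
          (b k - A k x) / c k <
            (J.filter fun j => c j < 0).sup' hlow (fun j => (b j - A j x) / c j)} =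
          {x | (b k - A k x) / c k <
            (J.filter fun j => c j < 0).sup' hlow (fun j => (b j - A j x) / c j)} := by
        ext x; simp [hkj]
      rw [this]; exact measurableSet_lt (hv k) hlo'
    · have : {x : ℝ × ℝ | k < j →
          (b k - A k x) / c k <
            (J.filter fun j => c j < 0).sup' hlow (fun j => (b j - A j x) / c j)} = univ := by
        ext x; simp [hkj]
      rw [this]; exact MeasurableSet.univ
  simpa only [setOf_and, setOf_mem_eq] using hD.inter (h1.inter h2)

/-- **The bottom graph as a sum over active constraints.**  For any measurable base `D` and any
integrand `Φ` with `x ↦ Φ x (hi x)` integrable on `D`: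
`∫_D Φ(x, lo x) = Σ_{j : c j < 0} ∫_{D_j} Φ(x, (b j − A j x)/c j)`, the pieces `D_j` (least active
index `j`) being measurable and pairwise disjoint with union `D`.
[cite: EvansGariepy2015, Thm 5.16 (Gauss–Green), polyhedral case — decomposition of the lower graph] -/
theorem setIntegral_bot_eq_sum_active {J : Finset ι} {A : ι → (ℝ × ℝ) → ℝ}
    (hA : ∀ j, Continuous (A j)) (c b : ι → ℝ) (hlow : (J.filter fun j => c j < 0).Nonempty)
    {D : Set (ℝ × ℝ)} (hD : MeasurableSet D) (Φ : (ℝ × ℝ) → ℝ → ℝ)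
    (hint : IntegrableOn (fun x => Φ x
      ((J.filter fun j => c j < 0).sup' hlow (fun j => (b j - A j x) / c j))) D volume) :
    ∫ x in D, Φ x ((J.filter fun j => c j < 0).sup' hlow (fun j => (b j - A j x) / c j)) =
      ∑ j ∈ J.filter (fun j => c j < 0),
        ∫ x in {x : ℝ × ℝ | x ∈ D ∧
          (b j - A j x) / c j = (J.filter fun j => c j < 0).sup' hlow (fun j => (b j - A j x) / c j) ∧
          ∀ k ∈ J.filter (fun j => c j < 0), k < j →
            (b k - A k x) / c k <
              (J.filter fun j => c j < 0).sup' hlow (fun j => (b j - A j x) / c j)}, Φ x ((b j - A j x) / c j) := by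
  classical
  set U := J.filter (fun j => c j < 0) with hU
  set lo : (ℝ × ℝ) → ℝ := fun x => U.sup' hlow (fun j => (b j - A j x) / c j) with hlo
  set piece : ι → Set (ℝ × ℝ) := fun j => {x : ℝ × ℝ | x ∈ D ∧ (b j - A j x) / c j = lo x ∧
    ∀ k ∈ U, k < j → (b k - A k x) / c k < lo x} with hpiece
  have hmeas : ∀ j ∈ U, MeasurableSet (piece j) := fun j _ =>
    measurableSet_activePiece_lower hA c b hlow hD j
  have hdisj : Set.Pairwise (↑U : Set ι) (Function.onFun Disjoint piece) := by
    intro j hj k hk hjk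
    rw [Function.onFun, Set.disjoint_left]
    intro x hxj hxk
    rcases lt_or_gt_of_ne hjk with h | h
    · have := hxk.2.2 j hj h
      rw [hxj.2.1] at this
      exact lt_irrefl _ this
    · have := hxj.2.2 k hk h
      rw [hxk.2.1] at this
      exact lt_irrefl _ this
  have hcover : D = ⋃ j ∈ U, piece j := by
    ext x
    simp only [mem_iUnion, exists_prop]
    constructor
    · intro hx
      obtain ⟨j, hjU, hj1, hj2⟩ := exists_least_active_lower A c b hlow x
      exact ⟨j, hjU, hx, hj1, hj2⟩
    · rintro ⟨j, -, hx, -⟩; exact hx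
  have step1 : ∫ x in D, Φ x (lo x) = ∑ j ∈ U, ∫ x in piece j, Φ x (lo x) := by
    rw [hcover]
    refine integral_biUnion_finset U hmeas hdisj fun j hj => ?_
    exact hint.mono_set (fun x hx => hx.1)
  rw [step1]
  refine Finset.sum_congr rfl fun j hj => ?_
  refine setIntegral_congr_fun (hmeas j hj) fun x hx => ?_
  rw [← hx.2.1]


/-- **Gauss–Green, vertical component, for an H-polyhedron, in FACET-SUM form.**  With the
notation of `setIntegral_deriv_hPolyhedron` (base `D`, graphs `lo ≤ hi`) and the least-active
pieces `D_j⁺` (`c j > 0`) / `D_j⁻` (`c j < 0`):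
`∫_P ∂_t g = Σ_{c j > 0} ∫_{D_j⁺} g(x, (b j − A j x)/c j) dx − Σ_{c j < 0} ∫_{D_j⁻} g(x, (b j − A j x)/c j) dx`.
(What remains for the facet formula: each piece integral is `|c j|/‖(A j, c j)‖` times the
integral of `g` over the `j`-th facet in an isometric chart — a linear change of variables.)
[cite: EvansGariepy2015, Thm 5.16 (Gauss–Green), polyhedral case, vertical component] -/
theorem setIntegral_deriv_hPolyhedron_eq_sum {J : Finset ι} {A : ι → (ℝ × ℝ) → ℝ}
    (hA : ∀ j, Continuous (A j)) (c b : ι → ℝ) (hup : (J.filter fun j => 0 < c j).Nonempty)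
    (hlow : (J.filter fun j => c j < 0).Nonempty) {g g' : (ℝ × ℝ) × ℝ → ℝ}
    (hderiv : ∀ x t, HasDerivAt (fun s => g (x, s)) (g' (x, t)) t) (hcont : Continuous g')
    (hint : IntegrableOn g' {p : (ℝ × ℝ) × ℝ | ∀ j ∈ J, A j p.1 + c j * p.2 ≤ b j} volume)
    (hghi : IntegrableOn (fun x => g (x, (J.filter fun j => 0 < c j).inf' hup
        (fun j => (b j - A j x) / c j)))
      {x : ℝ × ℝ | (∀ j ∈ J, c j = 0 → A j x ≤ b j) ∧
        (J.filter fun j => c j < 0).sup' hlow (fun j => (b j - A j x) / c j) ≤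
          (J.filter fun j => 0 < c j).inf' hup (fun j => (b j - A j x) / c j)} volume)
    (hglo : IntegrableOn (fun x => g (x, (J.filter fun j => c j < 0).sup' hlow
        (fun j => (b j - A j x) / c j)))
      {x : ℝ × ℝ | (∀ j ∈ J, c j = 0 → A j x ≤ b j) ∧
        (J.filter fun j => c j < 0).sup' hlow (fun j => (b j - A j x) / c j) ≤
          (J.filter fun j => 0 < c j).inf' hup (fun j => (b j - A j x) / c j)} volume) :
    ∫ p in {p : (ℝ × ℝ) × ℝ | ∀ j ∈ J, A j p.1 + c j * p.2 ≤ b j}, g' p =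
      (∑ j ∈ J.filter (fun j => 0 < c j),
        ∫ x in {x : ℝ × ℝ | x ∈ {x : ℝ × ℝ | (∀ j ∈ J, c j = 0 → A j x ≤ b j) ∧
            (J.filter fun j => c j < 0).sup' hlow (fun j => (b j - A j x) / c j) ≤
              (J.filter fun j => 0 < c j).inf' hup (fun j => (b j - A j x) / c j)} ∧
          (b j - A j x) / c j = (J.filter fun j => 0 < c j).inf' hup (fun j => (b j - A j x) / c j) ∧
          ∀ k ∈ J.filter (fun j => 0 < c j), k < j →
            (J.filter fun j => 0 < c j).inf' hup (fun j => (b j - A j x) / c j) <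
              (b k - A k x) / c k}, g (x, (b j - A j x) / c j)) -
      ∑ j ∈ J.filter (fun j => c j < 0),
        ∫ x in {x : ℝ × ℝ | x ∈ {x : ℝ × ℝ | (∀ j ∈ J, c j = 0 → A j x ≤ b j) ∧
            (J.filter fun j => c j < 0).sup' hlow (fun j => (b j - A j x) / c j) ≤
              (J.filter fun j => 0 < c j).inf' hup (fun j => (b j - A j x) / c j)} ∧
          (b j - A j x) / c j = (J.filter fun j => c j < 0).sup' hlow (fun j => (b j - A j x) / c j) ∧
          ∀ k ∈ J.filter (fun j => c j < 0), k < j →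
            (b k - A k x) / c k <
              (J.filter fun j => c j < 0).sup' hlow (fun j => (b j - A j x) / c j)},
          g (x, (b j - A j x) / c j) := by
  rw [setIntegral_deriv_hPolyhedron hA c b hup hlow hderiv hcont hint,
    integral_sub hghi hglo,
    setIntegral_top_eq_sum_active hA c b hup (measurableSet_baseOfHConstraints hA c b hup hlow)
      (fun x t => g (x, t)) hghi,
    setIntegral_bot_eq_sum_active hA c b hlow (measurableSet_baseOfHConstraints hA c b hup hlow)
      (fun x t => g (x, t)) hglo]

end Literature.MeasureTheory.Integral

end
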